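import Summits.QuantumFields.QCD.Theses.EulerDescent
import Literature.MathematicalPhysics.QuantumFieldTheory.QCDCurrentSector
import Summits.QuantumFields.QCD.Theorems.EulerDescentChiralCornerSoftnessStubCondensateFluxFloorNondegTwo
import Literature.Barriers.QuantumFields.WilsonDeterminantMassSplitting
import Mathlib.LinearAlgebra.Lagrange
import Mathlib.LinearAlgebra.Matrix.Polynomial
import HarnessLib

/-!
# Sub-goal `stub_condensateFluxFloor_rayZerosFinite` of line `Sketch`
(crux `Summit.QuantumFields.QCD.Theses.EulerDescent.ChiralCornerSoftness`, item stmt-QuantumFields-16902)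

**On the twisted ray only finitely many parameters give a vanishing denominator.**  For the twisted-mass Wilson
doublet `(f, g)` among `N_f` flavours, at fixed inverse coupling `β`, pin `mc`, slope `c ≠ 0` and torus side `2S+1`,
the gauge average of the Berezin weight on the ray `(m₀, μ) = (mc + ct, ct)`,
`Z(t) = ∫dμ_W(U) ∫dψ̄dψ e^{−ψ̄(D_W(U, mc + ct) ⊗ 1 + i(ct)γ₅ ⊗ τ³)ψ}`, vanishes for only FINITELY many real `t`
(`stub_condensateFluxFloor_rayZerosFinite`, the registered signature; the `let Tw` is textually the skeleton's
twisted-mass matrix).  So the `∃ t ≤ t₁` dodge of stub E3 around Lean-junk `x / 0` denominators is cheap.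

## Proof (everything is proved; no named fact is taken as a hypothesis; no new definitions)

* `RayZeros.exists_slope` — the ray matrix is AFFINE in `s = ct` with INVERTIBLE slope:
  `D_W(U, mc + s) ⊗ 1 + isγ₅ ⊗ τ³ = A(U) + s·B`, `A(U) = D_W(U, mc) ⊗ 1` (`wilsonDirac_add_mass`),
  `B = ⊕_{f'} (1 + i s_{f'} Γ₅)`, `s_{f'} = +1, −1, 0` on `f`, `g`, the rest (`Γ₅ = 1 ⊗ 1 ⊗ γ₅`), and
  `det B = ∏_{f'} det(1 + i s_{f'} Γ₅) ≠ 0` because `(1 + aΓ₅)(1 − aΓ₅) = (1 − a²)·1` (`Γ₅² = 1`) with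
  `a² = −s_{f'}² ∈ {0, −1}` (`NondegTwo.det_flavDiag`, `RayZeros.det_one_add_smul_spinorLift_ne_zero`).
* `RayZeros.eval_det_X_smul_add`, `RayZeros.det_X_smul_add_eq_sum` — for ANY square `A`, `B` over `ℂ`,
  `det(A + z·B)` is the value at `z` of `P = det(X·B + A) ∈ ℂ[X]`, of `natDegree ≤ n` with `X^n`-coefficient `det B`
  (`Polynomial.natDegree_det_X_add_C_le`, `Polynomial.coeff_det_X_add_C_card`); Lagrange interpolation at the `n+1`
  integer nodes `0, …, n` (`Lagrange.eq_interpolate`) writes `P = Σ_i P(i)·ℓ_i`, whence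
  `det(A + z·B) = Σ_i det(A + i·B) ℓ_i(z)` and `det B = Σ_i det(A + i·B) ℓ_i.coeff n`.
* `RayZeros.exists_rayPoly` — pointwise in `U` the Berezin weight is `det(A(U) + s·B)` (orientation sign `+1`,
  `NondegTwo.fermiIntegral_grassmannExp_quadratic_neg`); each nodal weight `U ↦ det(A(U) + i·B)` is the Berezin
  weight at the REAL parameters `(mc + i, i)`, integrable over the Wilson probability measure
  (`SlabFluxWard.coeffRegular_twWeight`, `SlabFluxWard.integrable_fermiIntegral`); so `Z = Q(s)` with
  `Q = Σ_i Z_i·ℓ_i ∈ ℂ[X]`, `Z_i = ∫ det(A(U) + i·B) dμ_W`, and `Q.coeff n = ∫ det B dμ_W = det B ≠ 0`.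
* A nonzero polynomial has finitely many roots (`Polynomial.finite_setOf_isRoot`) and `t ↦ (ct : ℂ)` is injective
  (`RayZeros.rayZeros_finite`).

References: I. Montvay, G. Münster, *Quantum Fields on a Lattice* (CUP 1994), §4.1.3 (4.17)–(4.22) (Gaussian Grassmann
integral = determinant, a polynomial in the couplings); R. Frezzotti, P. A. Grassi, S. Sint, P. Weisz, JHEP 08 (2001)
058, §2.1 (twisted-mass lattice Dirac operator `D_W + m + iμγ₅τ³`).
-/

noncomputable section

namespace Summit.QuantumFields.QCD.Cruxes.ChiralCornerSoftness.TwistedRay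

open Filter Topology MeasureTheory
open Literature.MathematicalPhysics.QuantumFieldTheory Literature.MathematicalPhysics.QuantumLattice
  Literature.Probability.LatticeModels

namespace RayZeros

open SlabFluxWard NondegTwo Polynomial

/-! ### `det(A + z·B)` is a polynomial in `z` of degree `≤ n` with `X^n`-coefficient `det B` -/

section DetPoly

variable {ι : Type*} [Fintype ι] [DecidableEq ι]

/-- Evaluation of the pencil determinant: `det(X·B + A)(z) = det(A + z·B)`. [folklore] -/
theorem eval_det_X_smul_add (A B : Matrix ι ι ℂ) (z : ℂ) :
    (Matrix.det ((X : ℂ[X]) • B.map C + A.map C)).eval z = (A + z • B).det := by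
  rw [← Polynomial.coe_evalRingHom, RingHom.map_det]
  congr 1
  ext i j
  simp only [Matrix.add_apply, Matrix.smul_apply, Matrix.map_apply, RingHom.mapMatrix_apply, smul_eq_mul,
    Polynomial.coe_evalRingHom, Polynomial.eval_add, Polynomial.eval_mul, Polynomial.eval_X, Polynomial.eval_C]
  ring

/-- The integer nodes `0, 1, …, n` are distinct complex numbers. [folklore] -/
theorem node_injOn (n : ℕ) :
    Set.InjOn (fun i : Fin (n + 1) => (((i : ℕ) : ℝ) : ℂ)) (Finset.univ : Finset (Fin (n + 1))) := by
  intro i _ j _ h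
  simp only [Complex.ofReal_natCast, Nat.cast_inj] at h
  exact Fin.ext h

/-- **Lagrange form of the pencil determinant** at the `n+1` integer nodes: `det(X·B + A) = Σ_i det(A + i·B)·ℓ_i`
(its degree is `≤ n < n + 1`, `Polynomial.natDegree_det_X_add_C_le`). [folklore] -/
theorem det_X_smul_add_eq_sum (A B : Matrix ι ι ℂ) :
    Matrix.det ((X : ℂ[X]) • B.map C + A.map C) = ∑ i : Fin (Fintype.card ι + 1),
      C ((A + (((i : ℕ) : ℝ) : ℂ) • B).det) *
        Lagrange.basis Finset.univ (fun i : Fin (Fintype.card ι + 1) => (((i : ℕ) : ℝ) : ℂ)) i := by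
  have hdeg : (Matrix.det ((X : ℂ[X]) • B.map C + A.map C)).degree <
      (Finset.univ : Finset (Fin (Fintype.card ι + 1))).card := by
    rw [Finset.card_univ, Fintype.card_fin]
    refine (Polynomial.degree_le_natDegree).trans_lt ?_
    exact_mod_cast Nat.lt_succ_of_le (Polynomial.natDegree_det_X_add_C_le _ _)
  conv_lhs => rw [Lagrange.eq_interpolate (node_injOn _) hdeg, Lagrange.interpolate_apply]
  simp only [eval_det_X_smul_add]

/-- `det(A + z·B) = Σ_i det(A + i·B) ℓ_i(z)`. [folklore] -/
theorem det_add_smul_eq_sum (A B : Matrix ι ι ℂ) (z : ℂ) :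
    (A + z • B).det = ∑ i : Fin (Fintype.card ι + 1), (A + (((i : ℕ) : ℝ) : ℂ) • B).det *
      (Lagrange.basis Finset.univ (fun i : Fin (Fintype.card ι + 1) => (((i : ℕ) : ℝ) : ℂ)) i).eval z := by
  rw [← eval_det_X_smul_add, det_X_smul_add_eq_sum, eval_finsetSum]
  simp only [eval_mul, eval_C]

/-- `det B = Σ_i det(A + i·B) ℓ_i.coeff n` (the `X^n`-coefficient, `Polynomial.coeff_det_X_add_C_card`). [folklore] -/
theorem det_eq_sum_coeff (A B : Matrix ι ι ℂ) :
    B.det = ∑ i : Fin (Fintype.card ι + 1), (A + (((i : ℕ) : ℝ) : ℂ) • B).det *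
      (Lagrange.basis Finset.univ (fun i : Fin (Fintype.card ι + 1) => (((i : ℕ) : ℝ) : ℂ)) i).coeff
        (Fintype.card ι) := by
  rw [← Polynomial.coeff_det_X_add_C_card B A, det_X_smul_add_eq_sum, finsetSum_coeff]
  simp only [coeff_C_mul]

end DetPoly

/-! ### The ray matrix is affine in the ray parameter, with invertible slope -/

section Affine

variable {Nf L : ℕ} [NeZero L]

omit [NeZero L] in
/-- Flavour-diagonal matrices scale blockwise. [folklore] -/
theorem smul_flavDiag (a : ℂ) (F : Fin Nf → Matrix (TorusSite 4 L × Fin 3 × Fin 4) (TorusSite 4 L × Fin 3 × Fin 4) ℂ) :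
    a • flavDiag F = flavDiag fun f' => a • F f' := by
  ext v w
  simp only [flavDiag, Matrix.smul_apply, Matrix.of_apply, smul_eq_mul]
  split_ifs <;> simp

/-- `(1 + aΓ₅)(1 − aΓ₅) = (1 − a²) · 1` since `Γ₅² = 1`. [folklore] -/
theorem one_add_smul_spinorLift_mul (a : ℂ) :
    ((1 : Matrix (TorusSite 4 L × Fin 3 × Fin 4) (TorusSite 4 L × Fin 3 × Fin 4) ℂ) + a • spinorLift gammaFive) *
        (1 - a • spinorLift gammaFive) =
      (1 - a ^ 2) • (1 : Matrix (TorusSite 4 L × Fin 3 × Fin 4) (TorusSite 4 L × Fin 3 × Fin 4) ℂ) := by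
  have hsq := spinorLift_gammaFive_mul_self (L := L) (N := 3)
  rw [mul_sub, mul_one, Matrix.mul_smul, add_mul, Matrix.one_mul, Matrix.smul_mul, hsq, smul_add, smul_smul,
    sub_smul, one_smul, pow_two]
  abel

/-- **Each flavour block of the slope is invertible**: `det(1 + i s_{f'} Γ₅) ≠ 0`, because
`det(1 + aΓ₅) det(1 − aΓ₅) = (1 − a²)^N` and `a² = −s_{f'}² ≠ 1`. [folklore] -/
theorem det_one_add_smul_spinorLift_ne_zero (f g f' : Fin Nf) :
    ((1 : Matrix (TorusSite 4 L × Fin 3 × Fin 4) (TorusSite 4 L × Fin 3 × Fin 4) ℂ) +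
        (twSign f g f' * Complex.I) • spinorLift gammaFive).det ≠ 0 := by
  intro h0
  have ha : (1 : ℂ) - (twSign f g f' * Complex.I) ^ 2 ≠ 0 := by
    unfold twSign
    split_ifs <;> norm_num [mul_pow, Complex.I_sq]
  have h := congrArg Matrix.det (one_add_smul_spinorLift_mul (L := L) (twSign f g f' * Complex.I))
  rw [Matrix.det_mul, h0, zero_mul, Matrix.det_smul, Matrix.det_one, mul_one] at h
  exact pow_ne_zero _ ha h.symm

/-- **The twisted Dirac matrix on the ray is affine in the ray parameter with invertible slope**: there is `B`
with `det B ≠ 0` and `D_W(U, mc + s) ⊗ 1 + isγ₅ ⊗ τ³ = D_W(U, mc) ⊗ 1 + s·B` for all `U`, `s` — namely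
`B = ⊕_{f'} (1 + i s_{f'} Γ₅)` (mass shift `wilsonDirac_add_mass`; `det` multiplicative over flavour blocks).
[cite: FrezzottiGrassiSintWeisz2001, §2.1] -/
theorem exists_slope (f g : Fin Nf) (mc : ℝ) :
    ∃ B : Matrix (FermiIdx Nf L) (FermiIdx Nf L) ℂ, B.det ≠ 0 ∧
      ∀ (U : GaugeConfig 4 L (Matrix.specialUnitaryGroup (Fin 3) ℂ)) (s : ℝ),
        diracMatrix U (fun _ : Fin Nf => mc + s) + Matrix.reindex quarkEquiv quarkEquiv (twistQ f g s) =
          diracMatrix U (fun _ : Fin Nf => mc) + (s : ℂ) • B := by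
  refine ⟨Matrix.reindex quarkEquiv quarkEquiv (flavDiag fun f' =>
    (1 : Matrix (TorusSite 4 L × Fin 3 × Fin 4) (TorusSite 4 L × Fin 3 × Fin 4) ℂ) +
      (twSign f g f' * Complex.I) • spinorLift gammaFive), ?_, fun U s => ?_⟩
  · rw [Matrix.det_reindex_self, det_flavDiag]
    exact Finset.prod_ne_zero_iff.2 fun f' _ => det_one_add_smul_spinorLift_ne_zero f g f'
  · have hQ : diracQ U (mc + s) + twistQ f g s = diracQ (Nf := Nf) U mc + (s : ℂ) • flavDiag fun f' =>
        (1 : Matrix (TorusSite 4 L × Fin 3 × Fin 4) (TorusSite 4 L × Fin 3 × Fin 4) ℂ) +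
          (twSign f g f' * Complex.I) • spinorLift gammaFive := by
      rw [diracQ_add_twistQ, diracQ, smul_flavDiag, flavDiag_add]
      congr 1
      funext f'
      rw [Pi.add_apply, smul_add, smul_smul, Literature.Barriers.QuantumFields.wilsonDirac_add_mass, add_assoc,
        mul_left_comm]
    have hre : diracMatrix U (fun _ : Fin Nf => mc + s) + Matrix.reindex quarkEquiv quarkEquiv (twistQ f g s) =
        Matrix.reindex quarkEquiv quarkEquiv (diracQ U (mc + s) + twistQ f g s) := by
      rw [diracMatrix_eq_reindex_diracQ]; rfl
    rw [hre, hQ, diracMatrix_eq_reindex_diracQ]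
    rfl

end Affine

/-! ### Integration over the gauge field: `Z` is a nonzero polynomial function of the ray parameter -/

section Integrate

variable {Nf : ℕ}

/-- **The gauge average of the ray weight is a NONZERO polynomial function of the ray parameter**: there is
`Q ∈ ℂ[X]`, `Q ≠ 0`, with `∫dμ_W(U) ∫dψ̄dψ e^{−ψ̄(D_W(U, mc + s) ⊗ 1 + isγ₅ ⊗ τ³)ψ} = Q(s)` for every real `s` —
`Q = Σ_i Z_i ℓ_i` interpolates the gauge averages `Z_i` at the integer nodes, and `Q.coeff n = ∫ det B dμ_W = det B`.
[cite: MontvayMunster1994, §4.1.3 (4.17)–(4.22)] -/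
theorem exists_rayPoly (β mc : ℝ) (f g : Fin Nf) (S : ℕ) :
    ∃ Q : ℂ[X], Q ≠ 0 ∧ ∀ s : ℝ,
      (∫ U, fermiIntegral (grassmannExp (quadratic ℂ (-(diracMatrix U (fun _ : Fin Nf => mc + s) +
            Matrix.reindex quarkEquiv quarkEquiv (twistQ f g s)))))
          ∂(wilsonMeasure (d := 4) (L := 2 * S + 1) (fundamentalRep (Fin 3)) β)) = Q.eval (s : ℂ) := by
  obtain ⟨B, hB, hray⟩ := exists_slope (L := 2 * S + 1) f g mc
  -- the Berezin weight on the ray is `det(A(U) + s·B)` (orientation sign `+1`)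
  have hW : ∀ (U : GaugeConfig 4 (2 * S + 1) (Matrix.specialUnitaryGroup (Fin 3) ℂ)) (s : ℝ),
      fermiIntegral (grassmannExp (quadratic ℂ (-(diracMatrix U (fun _ : Fin Nf => mc + s) +
          Matrix.reindex quarkEquiv quarkEquiv (twistQ f g s))))) =
        (diracMatrix U (fun _ : Fin Nf => mc) + (s : ℂ) • B).det := fun U s => by
    rw [fermiIntegral_grassmannExp_quadratic_neg, hray]
  -- each nodal weight is integrable (it is the Berezin weight at the real parameters `(mc + i, i)`)
  have hint : ∀ i : Fin (Fintype.card (FermiIdx Nf (2 * S + 1)) + 1),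
      Integrable (fun U => (diracMatrix U (fun _ : Fin Nf => mc) + (((i : ℕ) : ℝ) : ℂ) • B).det)
        (wilsonMeasure (d := 4) (L := 2 * S + 1) (fundamentalRep (Fin 3)) β) := fun i => by
    have h := integrable_fermiIntegral (coeffRegular_twWeight (L := 2 * S + 1) (mc + ((i : ℕ) : ℝ)) ((i : ℕ) : ℝ) f g)
      (wilsonMeasure (d := 4) (L := 2 * S + 1) (fundamentalRep (Fin 3)) β)
    simp only [hW] at h
    exact h
  refine ⟨∑ i : Fin (Fintype.card (FermiIdx Nf (2 * S + 1)) + 1),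
    C (∫ U, (diracMatrix U (fun _ : Fin Nf => mc) + (((i : ℕ) : ℝ) : ℂ) • B).det
        ∂(wilsonMeasure (d := 4) (L := 2 * S + 1) (fundamentalRep (Fin 3)) β)) *
      Lagrange.basis Finset.univ (fun i : Fin (Fintype.card (FermiIdx Nf (2 * S + 1)) + 1) => (((i : ℕ) : ℝ) : ℂ)) i,
    fun h0 => hB ?_, fun s => ?_⟩
  · -- `Q.coeff n = ∫ Σ_i det(A(U) + i·B) ℓ_i.coeff n dμ_W = ∫ det B dμ_W = det B`, so `Q = 0` forces `det B = 0`
    have hc := congrArg (fun Q : ℂ[X] => Q.coeff (Fintype.card (FermiIdx Nf (2 * S + 1)))) h0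
    simp only [finsetSum_coeff, coeff_C_mul, coeff_zero] at hc
    rw [← hc]
    simp_rw [← integral_mul_const]
    rw [← integral_finsetSum _ fun i _ => (hint i).mul_const _]
    simp_rw [← det_eq_sum_coeff]
    rw [integral_const]
    simp
  · simp_rw [hW, det_add_smul_eq_sum _ B (s : ℂ)]
    rw [integral_finsetSum _ fun i _ => (hint i).mul_const _, eval_finsetSum]
    simp only [eval_mul, eval_C]
    exact Finset.sum_congr rfl fun i _ => integral_mul_const _ _

/-- **Only finitely many ray parameters give a vanishing denominator** (stated with `SlabFluxWard.twistQ`, which is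
verbatim the body of the skeleton's `Tw`). [folklore] -/
theorem rayZeros_finite (f g : Fin Nf) (β mc : ℝ) {c : ℝ} (hc : c ≠ 0) (S : ℕ) :
    Set.Finite {t : ℝ | (∫ U, fermiIntegral (grassmannExp (quadratic ℂ (-(diracMatrix U (fun _ : Fin Nf => mc + c * t) +
          Matrix.reindex quarkEquiv quarkEquiv (twistQ f g (c * t))))))
        ∂(wilsonMeasure (d := 4) (L := 2 * S + 1) (fundamentalRep (Fin 3)) β)) = 0} := by
  obtain ⟨Q, hQ, hZ⟩ := exists_rayPoly β mc f g S
  simp_rw [hZ]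
  have hinj : Function.Injective fun t : ℝ => ((c * t : ℝ) : ℂ) :=
    Complex.ofReal_injective.comp (mul_right_injective₀ hc)
  exact (Polynomial.finite_setOf_isRoot hQ).preimage hinj.injOn

end Integrate

end RayZeros

open RayZeros in
/-- **Registered sub-goal `stub_condensateFluxFloor_rayZerosFinite` of line `Sketch`: on the twisted ray only
finitely many parameters give a vanishing denominator.**  For the doublet `(f, g)` among `N_f` flavours, every `β`,
pin `mc`, slope `c ≠ 0` and torus side `2S+1`, the set of real `t` with
`∫dμ_W(U) ∫dψ̄dψ e^{−ψ̄(D_W(U, mc + ct) ⊗ 1 + i(ct)γ₅ ⊗ τ³)ψ} = 0` is finite: the gauge average is the value at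
`ct` of a polynomial whose top coefficient is `det B ≠ 0` (`RayZeros.exists_rayPoly`, `RayZeros.exists_slope`).
The `let Tw` is textually the skeleton's twisted-mass matrix. [cite: MontvayMunster1994, §4.1.3 (4.17)–(4.22)] -/
theorem stub_condensateFluxFloor_rayZerosFinite : ∀ (Nf : ℕ) (f g : Fin Nf) (β mc c : ℝ) (S : ℕ), c ≠ 0 → let Tw := fun (S : ℕ) (μl : ℝ) => Matrix.reindex (quarkEquiv (Nf := Nf) (L := 2 * S + 1)) quarkEquiv (Matrix.of fun v w : QuarkVar Nf (2 * S + 1) => if v.1 = w.1 ∧ v.2.1 = w.2.1 ∧ v.2.2.1 = w.2.2.1 then (if v.1 = f then (1 : ℂ) else if v.1 = g then -1 else 0) * ((μl : ℂ) * Complex.I) * gammaFive v.2.2.2 w.2.2.2 else 0); Set.Finite {t : ℝ | (∫ U, fermiIntegral (grassmannExp (quadratic ℂ (-(diracMatrix U (fun _ : Fin Nf => mc + c * t) + Tw S (c * t))))) ∂(wilsonMeasure (d := 4) (L := 2 * S + 1) (fundamentalRep (Fin 3)) β)) = 0} := by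
  intro Nf f g β mc c S hc
  dsimp only
  exact rayZeros_finite f g β mc hc S

end Summit.QuantumFields.QCD.Cruxes.ChiralCornerSoftness.TwistedRay

end
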